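/-
Copyright: lead seat `ym-line-sll-p1` (prover-ym-line-sll-p1-g0-0), route `SoftLoopLongLag`, crux `ColdBoxSoftLoopLagFloor`
(stmt-QuantumFields-24180; stub E1b `stub_innerDatumCovStabilityG` of `Cruxes/ColdBoxSoftLoopLagFloor/Lines/birth.lean` v7).
-/
import Summits.QuantumFields.YangMills.Theorems.SoftLoopLongLagDirichletLagFormDrift
import Summits.QuantumFields.YangMills.Theorems.SoftLoopLongLagBackgroundLoopFlux

/-!
# The price of the LINEAR background term of stub E1b: `Σ_{x,x'} Φ̄(x+c) Φ̄(x'+c+Te₀) M_D ≥ −E·#cube²·R⁴·(C_L·T²/H⁶ + K_L·R⁴/H⁸)`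
# (route `SoftLoopLongLag`, G-free)

WHAT.  For a one-colour Dirichlet datum `θ` on the cold-wall box `[0,2H]⁴` with linearised energy `E = formM θ s` (any competitor `s`), let
`Φ̄(y) = Σ_{p ∈ S(y)} d₁(glue θ (mean θ))(p; 1,2)` be the flux of the harmonic background through the spanning surface of the `R×R` square at `y`.
* `abs_backgroundFlux_shift_sub_le` — time drift over `t` steps: `|Φ̄(x + te₀) − Φ̄(x)| ≤ t·R²·C√E/H³` (telescoped from ym-line-sll-p4's gradient bound
  `backgroundFlux_interior_bounds`);
* **`linearTerm_ge`** — with `a = Φ̄(·+c)`, `b = Φ̄(·+c+Te₀)` in the two-weight Dirichlet lag form (`sum_sum_mul_mul_dirInductance_lag_ge_of_abs_sub_le`: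
  `B_D(a,b) ≥ −(C₁/4)#cube²·‖b−a‖∞² − (K R⁴/H⁴)Σ|a|Σ|b|`), the sizes `‖b − a‖∞ ≤ T R²C√E/H³`, `|a|, |b| ≤ R²C√E/H²` give
  `Σ_{x,x'∈cube_R} Φ̄(x+c)Φ̄(x'+c+Te₀)·M_D(S(x+c),S(x'+c+Te₀)) ≥ −E·#cube_R²·R⁴·(C_L·T²/H⁶ + K_L·R⁴/H⁸)` (`H ≥ 32`, `T ≥ R`, all squares
  `S(x+c+ie₀)`, `i ≤ T`, based within `H/8` of the centre), absolute constants `C_L, K_L`.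

WHY.  Summed over the `D` colours with `Σ_c E_c ≤ CE·(2H+3)⁴β^{κ−1}` and multiplied by `2β`, at `T = R`, `#cube ≤ 27R³`: the linear term of
`β²·Cov_ζ(F_sh, F_sh∘α_R)` is `≥ −C'·CE·R¹²β^κ/H²` — the registered price of E1b — with NO sign assumption on the background (positivity of the lag form).

HONEST LABEL.  Free-field bookkeeping for a RECORD-label rung line (R2xi-G, leaf `WeakCouplingRates.XiPow` = an UPPER bound on the lattice mass gap,
all compact simple `G`); NOT the Clay mass gap; no summit statement is touched.
-/

set_option autoImplicit false

noncomputable section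

open Finset
open Literature.Probability.LatticeModels (Site)
open Literature.MathematicalPhysics.QuantumLattice (ZdPlaquette)
open Literature.MathematicalPhysics.QuantumFieldTheory
open Literature.MathematicalPhysics.QuantumFieldTheory.LatticeMaxwell
open Literature.MathematicalPhysics.QuantumFieldTheory.AxialGauge
open Literature.MathematicalPhysics.QuantumFieldTheory.LatticeChain
open Literature.MathematicalPhysics.QuantumFieldTheory.LatticeForm (d₁)
open Summit.QuantumFields.YangMills.Theorems.WeakCouplingRates

namespace Summit.QuantumFields.YangMills.Theorems.SoftLoopLongLag

variable {H : ℕ}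

/-- **Time drift of the background flux** over `t` unit steps: `|Φ̄(x + te₀) − Φ̄(x)| ≤ t·R²·C√E/H³` (telescoping the gradient bound). -/
theorem abs_backgroundFlux_shift_sub_le :
    ∃ C : ℝ, 0 ≤ C ∧ ∀ (H : ℕ), 8 ≤ H →
      ∀ (θ : Literature.MathematicalPhysics.QuantumLattice.ZdEdge 4 → ℝ) (s : DirFree H → ℝ) (x : Site 4) (R t : ℕ),
        (∀ i : ℕ, i ≤ t → ∀ p ∈ rectSurface (x + Pi.single 0 (i : ℤ)) R R, ‖p.1 - boxCentre H‖ ≤ (H : ℝ) / 8) →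
          |(∑ p ∈ rectSurface (x + Pi.single 0 (t : ℤ)) R R,
              d₁ (fun z (i : Fin 4) => LatticeMaxwell.glue (pin := fun e => e ∉ dirFreeEdges H) dirCorner (2 * H + 3) θ
                (mean (fun e => e ∉ dirFreeEdges H) dirCorner (2 * H + 3) θ) (z, i)) p.1 1 2) - (∑ p ∈ rectSurface (x) R R,
              d₁ (fun z (i : Fin 4) => LatticeMaxwell.glue (pin := fun e => e ∉ dirFreeEdges H) dirCorner (2 * H + 3) θ
                (mean (fun e => e ∉ dirFreeEdges H) dirCorner (2 * H + 3) θ) (z, i)) p.1 1 2)| ≤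
            (t : ℝ) * ((R : ℝ) ^ 2 * (C * Real.sqrt (formM (fun e => e ∉ dirFreeEdges H) dirCorner (2 * H + 3) θ s) / (H : ℝ) ^ 3)) := by
  obtain ⟨C, hC0, hI⟩ := backgroundFlux_interior_bounds
  refine ⟨C, hC0, fun H hH θ s x R t hnear => ?_⟩
  obtain ⟨B, hB⟩ : ∃ B : ℕ → ℝ, ∀ i : ℕ, B i = (∑ p ∈ rectSurface (x + Pi.single 0 (i : ℤ)) R R,
              d₁ (fun z (i : Fin 4) => LatticeMaxwell.glue (pin := fun e => e ∉ dirFreeEdges H) dirCorner (2 * H + 3) θ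
                (mean (fun e => e ∉ dirFreeEdges H) dirCorner (2 * H + 3) θ) (z, i)) p.1 1 2) := ⟨_, fun _ => rfl⟩
  obtain ⟨D, hD⟩ : ∃ D : ℝ, D = (R : ℝ) ^ 2 * (C * Real.sqrt (formM (fun e => e ∉ dirFreeEdges H) dirCorner (2 * H + 3) θ s) /
      (H : ℝ) ^ 3) := ⟨_, rfl⟩
  have hstep : ∀ i : ℕ, i + 1 ≤ t → |B (i + 1) - B i| ≤ D := by
    intro i hi
    have hx1 : x + Pi.single 0 (((i + 1 : ℕ) : ℤ)) = x + Pi.single 0 (i : ℤ) + Pi.single 0 1 := by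
      rw [Nat.cast_succ, Pi.single_add, add_assoc]
    have h1 : ∀ p ∈ rectSurface (x + Pi.single 0 (i : ℤ)) R R, ‖p.1 - boxCentre H‖ ≤ (H : ℝ) / 8 :=
      fun p hp => hnear i (by omega) p (by simpa using hp)
    have h2 := ((hI H hH θ s (x + Pi.single 0 (i : ℤ)) R (fun p hp => h1 p (by simpa using hp))).2 0)
    rw [hB (i + 1), hB i, hD, hx1]
    exact h2
  have htel : |B t - B 0| ≤ (t : ℝ) * D := by
    rw [← Finset.sum_range_sub B t]
    refine (abs_sum_le_sum_abs _ _).trans ?_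
    calc ∑ i ∈ Finset.range t, |B (i + 1) - B i| ≤ ∑ _i ∈ Finset.range t, D :=
          Finset.sum_le_sum fun i hi => hstep i (by have := Finset.mem_range.1 hi; omega)
      _ = (t : ℝ) * D := by rw [Finset.sum_const, Finset.card_range, nsmul_eq_mul]
  have hx0 : x + Pi.single 0 ((0 : ℕ) : ℤ) = x := by simp
  have hBt := hB t
  have hB0 := hB 0
  rw [hx0] at hB0
  rw [← hBt, ← hB0, ← hD]
  exact htel

/-- **The linear-term price.**  Absolute constants `C_L, K_L ≥ 0` such that for `H ≥ 32`, `T ≥ R`, any centre `c`, any one-colour datum `θ` (energy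
`E = formM θ s` for any `s`), if every square `S(x + c + ie₀)` (`x ∈ cube_R`, `i ≤ T`) is based within `H/8` of `boxCentre H`, then
`−E·#cube_R²·R⁴·(C_L·T²/H⁶ + K_L·R⁴/H⁸) ≤ Σ_{x,x'} Φ̄(x+c)·Φ̄(x'+c+Te₀)·M_D(S(x+c), S(x'+c+Te₀))`. -/
theorem linearTerm_ge :
    ∃ C_L K_L : ℝ, 0 ≤ C_L ∧ 0 ≤ K_L ∧ ∀ (H : ℕ), (32 : ℝ) ≤ H → ∀ (R T : ℕ), R ≤ T →
      ∀ (c : Site 4) (θ : Literature.MathematicalPhysics.QuantumLattice.ZdEdge 4 → ℝ) (s : DirFree H → ℝ),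
        (∀ x ∈ timeZeroCube R, ∀ i : ℕ, i ≤ T → ∀ p ∈ rectSurface (x + c + Pi.single 0 (i : ℤ)) R R, ‖p.1 - boxCentre H‖ ≤ (H : ℝ) / 8) →
        -(formM (fun e => e ∉ dirFreeEdges H) dirCorner (2 * H + 3) θ s * ((timeZeroCube R).card : ℝ) ^ 2 * (R : ℝ) ^ 4 *
            (C_L * (T : ℝ) ^ 2 / (H : ℝ) ^ 6 + K_L * (R : ℝ) ^ 4 / (H : ℝ) ^ 8)) ≤
          ∑ x ∈ timeZeroCube R, ∑ x' ∈ timeZeroCube R, (∑ p ∈ rectSurface (x + c) R R,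
              d₁ (fun z (i : Fin 4) => LatticeMaxwell.glue (pin := fun e => e ∉ dirFreeEdges H) dirCorner (2 * H + 3) θ
                (mean (fun e => e ∉ dirFreeEdges H) dirCorner (2 * H + 3) θ) (z, i)) p.1 1 2) * (∑ p ∈ rectSurface (x' + c + Pi.single 0 (T : ℤ)) R R,
              d₁ (fun z (i : Fin 4) => LatticeMaxwell.glue (pin := fun e => e ∉ dirFreeEdges H) dirCorner (2 * H + 3) θ
                (mean (fun e => e ∉ dirFreeEdges H) dirCorner (2 * H + 3) θ) (z, i)) p.1 1 2) *
            ∑ p ∈ rectSurface (x + c) R R, ∑ q ∈ rectSurface (x' + c + Pi.single 0 (T : ℤ)) R R,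
              boxDirProjKernel H ((p.1, p.2.1.1, p.2.1.2) : Plaq 4) ((q.1, q.2.1.1, q.2.1.2) : Plaq 4) := by
  obtain ⟨C₁, K, hC₁, hK0, hform⟩ := sum_sum_mul_mul_dirInductance_lag_ge_of_abs_sub_le
  obtain ⟨C, hC0, hI⟩ := backgroundFlux_interior_bounds
  obtain ⟨C', hC0', hdrift⟩ := abs_backgroundFlux_shift_sub_le
  refine ⟨C₁ / 4 * C' ^ 2, K * C ^ 2, by positivity, by positivity, fun H hH R T hRT c θ s hnear => ?_⟩
  have hH8 : 8 ≤ H := by exact_mod_cast (show (8 : ℝ) ≤ H by linarith)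
  have hH0 : (0 : ℝ) < H := by linarith
  set E : ℝ := formM (fun e => e ∉ dirFreeEdges H) dirCorner (2 * H + 3) θ s with hE
  have hE0 : 0 ≤ E := by rw [hE, formM]; exact Finset.sum_nonneg fun p _ => sq_nonneg _
  -- the weights and their sizes
  obtain ⟨a, ha⟩ : ∃ a : Site 4 → ℝ, ∀ x, a x = (∑ p ∈ rectSurface (x + c) R R,
              d₁ (fun z (i : Fin 4) => LatticeMaxwell.glue (pin := fun e => e ∉ dirFreeEdges H) dirCorner (2 * H + 3) θ
                (mean (fun e => e ∉ dirFreeEdges H) dirCorner (2 * H + 3) θ) (z, i)) p.1 1 2) := ⟨_, fun _ => rfl⟩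
  obtain ⟨b, hb⟩ : ∃ b : Site 4 → ℝ, ∀ x, b x = (∑ p ∈ rectSurface (x + c + Pi.single 0 (T : ℤ)) R R,
              d₁ (fun z (i : Fin 4) => LatticeMaxwell.glue (pin := fun e => e ∉ dirFreeEdges H) dirCorner (2 * H + 3) θ
                (mean (fun e => e ∉ dirFreeEdges H) dirCorner (2 * H + 3) θ) (z, i)) p.1 1 2) := ⟨_, fun _ => rfl⟩
  have hnear0 : ∀ x ∈ timeZeroCube R, ∀ p ∈ rectSurface (x + c) R R, ‖p.1 - boxCentre H‖ ≤ (H : ℝ) / 8 := by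
    intro x hx p hp
    have hx0 : x + c + Pi.single 0 ((0 : ℕ) : ℤ) = x + c := by simp
    exact hnear x hx 0 (Nat.zero_le _) p (by rw [hx0]; exact hp)
  have hnearT : ∀ x ∈ timeZeroCube R, ∀ p ∈ rectSurface (x + c + Pi.single 0 (T : ℤ)) R R, ‖p.1 - boxCentre H‖ ≤ (H : ℝ) / 8 :=
    fun x hx p hp => hnear x hx T le_rfl p (by simpa using hp)
  set A : ℝ := (T : ℝ) * ((R : ℝ) ^ 2 * (C' * Real.sqrt E / (H : ℝ) ^ 3)) with hA
  set M : ℝ := (R : ℝ) ^ 2 * (C * Real.sqrt E / (H : ℝ) ^ 2) with hM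
  have hAbd : ∀ x ∈ timeZeroCube R, |b x - a x| ≤ A := by
    intro x hx
    have h := hdrift H hH8 θ s (x + c) R T (fun i hi p hp => hnear x hx i hi p (by simpa using hp))
    rw [hb, ha]
    exact h
  have haM : ∀ x ∈ timeZeroCube R, |a x| ≤ M := fun x hx => by
    rw [ha]; exact (hI H hH8 θ s _ R (hnear0 x hx)).1
  have hbM : ∀ x ∈ timeZeroCube R, |b x| ≤ M := fun x hx => by
    rw [hb]; exact (hI H hH8 θ s _ R (hnearT x hx)).1
  have hB := hform H hH R T hRT c a b A hAbd hnear0 hnearT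
  -- sizes of the sums of absolute weights
  set n : ℝ := ((timeZeroCube R).card : ℝ) with hn
  have hsa : ∑ x ∈ timeZeroCube R, |a x| ≤ n * M := by
    have := Finset.sum_le_sum haM; simpa [Finset.sum_const, nsmul_eq_mul, hn] using this
  have hsb : ∑ x ∈ timeZeroCube R, |b x| ≤ n * M := by
    have := Finset.sum_le_sum hbM; simpa [Finset.sum_const, nsmul_eq_mul, hn] using this
  have hsa0 : 0 ≤ ∑ x ∈ timeZeroCube R, |a x| := Finset.sum_nonneg fun _ _ => abs_nonneg _
  have hsb0 : 0 ≤ ∑ x ∈ timeZeroCube R, |b x| := Finset.sum_nonneg fun _ _ => abs_nonneg _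
  have hprod : (∑ x ∈ timeZeroCube R, |a x|) * (∑ x ∈ timeZeroCube R, |b x|) ≤ (n * M) * (n * M) :=
    mul_le_mul hsa hsb hsb0 ((hsa0.trans hsa))
  have hKRH : 0 ≤ K * (R : ℝ) ^ 4 / (H : ℝ) ^ 4 := by positivity
  -- the closed forms: `A² = T² R⁴ C'² E / H⁶`, `M² = R⁴ C² E / H⁴`
  have hsqE : Real.sqrt E ^ 2 = E := Real.sq_sqrt hE0
  have hA2 : A ^ 2 = (T : ℝ) ^ 2 * (R : ℝ) ^ 4 * C' ^ 2 * E / (H : ℝ) ^ 6 := by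
    calc A ^ 2 = ((T : ℝ) * (R : ℝ) ^ 2 * C' / (H : ℝ) ^ 3) ^ 2 * Real.sqrt E ^ 2 := by rw [hA]; ring
      _ = (T : ℝ) ^ 2 * (R : ℝ) ^ 4 * C' ^ 2 * E / (H : ℝ) ^ 6 := by rw [hsqE]; ring
  have hM2 : (n * M) * (n * M) = n ^ 2 * (R : ℝ) ^ 4 * C ^ 2 * E / (H : ℝ) ^ 4 := by
    calc (n * M) * (n * M) = (n * (R : ℝ) ^ 2 * C / (H : ℝ) ^ 2) ^ 2 * Real.sqrt E ^ 2 := by rw [hM]; ring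
      _ = n ^ 2 * (R : ℝ) ^ 4 * C ^ 2 * E / (H : ℝ) ^ 4 := by rw [hsqE]; ring
  have hfinal : -(C₁ / 4 * n ^ 2 * A ^ 2) - K * (R : ℝ) ^ 4 / (H : ℝ) ^ 4 * ((n * M) * (n * M)) =
      -(E * n ^ 2 * (R : ℝ) ^ 4 * (C₁ / 4 * C' ^ 2 * (T : ℝ) ^ 2 / (H : ℝ) ^ 6 + K * C ^ 2 * (R : ℝ) ^ 4 / (H : ℝ) ^ 8)) := by
    rw [hA2, hM2]; field_simp; ring
  calc -(E * n ^ 2 * (R : ℝ) ^ 4 * (C₁ / 4 * C' ^ 2 * (T : ℝ) ^ 2 / (H : ℝ) ^ 6 + K * C ^ 2 * (R : ℝ) ^ 4 / (H : ℝ) ^ 8))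
      = -(C₁ / 4 * n ^ 2 * A ^ 2) - K * (R : ℝ) ^ 4 / (H : ℝ) ^ 4 * ((n * M) * (n * M)) := hfinal.symm
    _ ≤ -(C₁ / 4 * n ^ 2 * A ^ 2) - K * (R : ℝ) ^ 4 / (H : ℝ) ^ 4 *
          ((∑ x ∈ timeZeroCube R, |a x|) * (∑ x ∈ timeZeroCube R, |b x|)) := by
        have := mul_le_mul_of_nonneg_left hprod hKRH
        linarith
    _ ≤ _ := by simpa only [ha, hb] using hB

end Summit.QuantumFields.YangMills.Theorems.SoftLoopLongLag

end
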